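import Literature.NumberTheory.LFunctions.GranvilleSoundararajan2003
import Literature.NumberTheory.LFunctions.GranvilleSoundararajanCosPrimeSum
import HarnessLib

/-!
# Granville–Soundararajan 2003, Lemma 2.3 — proof

Topic `Literature/NumberTheory/LFunctions`. Everything in this file is PROVED; it discharges the
named fact `GranvilleSoundararajan2003_lemma23` of `GranvilleSoundararajan2003.lean`
(A. Granville, K. Soundararajan, *Decay of mean values of multiplicative functions*, Canad. J.
Math. 55 (2003), Lemma 2.3, arXiv math/9911246 p. 5):

for a multiplicative `f` with `|f| ≤ 1`, `x ≥ 3`, all real `y` and `1/log x ≤ |β| ≤ log x`,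
`|F(1+iy) F(1+i(y+β))| ≪ (log x)^{4/π} max(1/|β|, (log log x)²)^{2(1-2/π)}`,
`F(s) = ∏_{p ≤ x} (1 + f(p)/p^s + f(p²)/p^{2s} + …)` (`truncEulerProduct`).

Following the printed proof: (2.7) `|F(1+iy)F(1+i(y+β))| ≪ exp(Re ∑_{p≤x} (f(p)p^{-iy} +
f(p)p^{-i(y+β)})/p) ≤ exp(∑_{p≤x} |1 + p^{-iβ}|/p) = exp(∑_{p≤x} 2|cos((β/2) log p)|/p)`
(`norm_truncEulerProduct_mul_le`: each Euler factor satisfies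
`|F_p(s)| ≤ exp(Re f(p)p^{-s} + 3/(p(p-1)))` on `Re s = 1`, and `∑_p 3/(p(p-1)) ≤ 3`), and then the
prime-sum estimate `∑_{p≤x} |cos((β/2) log p)|/p ≤ (2/π) log log x + (1 - 2/π) log max(1/|β|,
(log log x)²) + O(1)` PROVED in `GranvilleSoundararajanCosPrimeSum.lean`
(`sum_abs_cos_log_prime_div_le`, from the prime number theorem with the de la Vallée Poussin error
term and the mean value `2/π` of `|cos|`).

* `GranvilleSoundararajan2003_lemma23_holds : GranvilleSoundararajan2003_lemma23`.

## References

* A. Granville, K. Soundararajan, *Decay of mean values of multiplicative functions*, Canad. J.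
  Math. 55 (2003), 1191–1230, Lemma 2.3 (arXiv math/9911246, p. 5). [GranvilleSoundararajan2003]
-/

noncomputable section

open Finset Real Complex
open Literature.NumberTheory.LFunctions.Mertens

namespace Literature.NumberTheory.LFunctions.GranvilleSoundararajan

/-! ### One Euler factor on the line `Re s = 1` -/

/-- `‖p^{-s}‖ = 1/p` on `Re s = 1`. [folklore] -/
theorem norm_natCast_cpow_neg_of_re_eq_one {p : ℕ} (hp : 2 ≤ p) {s : ℂ} (hs : s.re = 1) :
    ‖(p : ℂ) ^ (-s)‖ = (p : ℝ)⁻¹ := by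
  have hp0 : 0 < p := by omega
  rw [Complex.norm_natCast_cpow_of_pos hp0, Complex.neg_re, hs, Real.rpow_neg_one]

/-- The Euler factor at `s` (`Re s = 1`) is `1 + f(p)p^{-s}` up to `∑_{k ≥ 2} p^{-k} = 1/(p(p-1))`.
[folklore] -/
theorem norm_eulerFactor_sub_one_add_le {g : ℕ → ℂ} (hg : ∀ n, ‖g n‖ ≤ 1) (hg1 : g 1 = 1) {p : ℕ}
    (hp : 2 ≤ p) {s : ℂ} (hs : s.re = 1) :
    ‖eulerFactor g p s - (1 + g p * (p : ℂ) ^ (-s))‖ ≤ 1 / ((p : ℝ) * ((p : ℝ) - 1)) := by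
  have hp1 : (1 : ℝ) < p := by exact_mod_cast hp
  have hp0 : (0 : ℝ) < p := by linarith
  set F : ℕ → ℂ := fun k => g (p ^ k) * (p : ℂ) ^ (-(s * k)) with hF
  have hsum : Summable F := summable_eulerFactor hg hp (s := s) (by rw [hs]; exact one_pos)
  have hsum1 : Summable fun k : ℕ => F (k + 1) := (summable_nat_add_iff 1).2 hsum
  have hsum2 : Summable fun k : ℕ => F (k + 1 + 1) := (summable_nat_add_iff 1).2 hsum1
  have h0 : ∑' k, F k = F 0 + ∑' k, F (k + 1) := hsum.tsum_eq_zero_add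
  have h1 : ∑' k, F (k + 1) = F (0 + 1) + ∑' k, F (k + 1 + 1) := hsum1.tsum_eq_zero_add
  have hF0 : F 0 = 1 := by simp [hF, hg1]
  have hF1 : F (0 + 1) = g p * (p : ℂ) ^ (-s) := by simp [hF]
  have e : eulerFactor g p s - (1 + g p * (p : ℂ) ^ (-s)) = ∑' k, F (k + 1 + 1) := by
    rw [show eulerFactor g p s = ∑' k, F k from rfl, h0, h1, hF0, hF1]; ring
  rw [e]
  set r : ℝ := (p : ℝ)⁻¹ with hr_def
  have hr : r < 1 := inv_lt_one_of_one_lt₀ hp1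
  have hr0 : 0 ≤ r := by positivity
  have hterm : ∀ k : ℕ, ‖F (k + 1 + 1)‖ ≤ r ^ 2 * r ^ k := by
    intro k
    have := norm_term_le hg hp s (k + 1 + 1)
    rw [hs, Real.rpow_neg_one] at this
    calc ‖F (k + 1 + 1)‖ ≤ (p : ℝ)⁻¹ ^ (k + 1 + 1) := this
      _ = r ^ 2 * r ^ k := by rw [hr_def]; ring
  have hgeo : HasSum (fun k : ℕ => r ^ 2 * r ^ k) (r ^ 2 * (1 - r)⁻¹) :=
    (hasSum_geometric_of_lt_one hr0 hr).mul_left _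
  calc ‖∑' k : ℕ, F (k + 1 + 1)‖ ≤ ∑' k : ℕ, ‖F (k + 1 + 1)‖ := norm_tsum_le_tsum_norm hsum2.norm
    _ ≤ ∑' k : ℕ, r ^ 2 * r ^ k := hsum2.norm.tsum_le_tsum hterm hgeo.summable
    _ = r ^ 2 * (1 - r)⁻¹ := hgeo.tsum_eq
    _ = 1 / ((p : ℝ) * ((p : ℝ) - 1)) := by
        rw [hr_def]
        field_simp

/-- **One Euler factor**: `‖F_p(s)‖ ≤ exp(Re(f(p)p^{-s}) + 3/(p(p-1)))` on `Re s = 1` (from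
`‖1 + z‖ ≤ exp(Re z + |z|²/2)` and the tail `1/(p(p-1))`). [folklore] -/
theorem norm_eulerFactor_le_exp_re {g : ℕ → ℂ} (hg : ∀ n, ‖g n‖ ≤ 1) (hg1 : g 1 = 1) {p : ℕ}
    (hp : 2 ≤ p) {s : ℂ} (hs : s.re = 1) :
    ‖eulerFactor g p s‖ ≤ Real.exp ((g p * (p : ℂ) ^ (-s)).re + 3 / ((p : ℝ) * ((p : ℝ) - 1))) := by
  have hp1 : (1 : ℝ) < p := by exact_mod_cast hp
  have hp2 : (2 : ℝ) ≤ p := by exact_mod_cast hp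
  have hp0 : (0 : ℝ) < p := by linarith
  set z : ℂ := g p * (p : ℂ) ^ (-s) with hz
  set R : ℝ := 1 / ((p : ℝ) * ((p : ℝ) - 1)) with hR
  have hpp : 0 < (p : ℝ) * ((p : ℝ) - 1) := mul_pos hp0 (by linarith)
  have hR0 : 0 ≤ R := by rw [hR]; exact div_nonneg zero_le_one hpp.le
  have hzn : ‖z‖ ≤ (p : ℝ)⁻¹ := by
    rw [hz, norm_mul, norm_natCast_cpow_neg_of_re_eq_one hp hs]
    exact mul_le_of_le_one_left (by positivity) (hg p)
  have happrox : ‖eulerFactor g p s - (1 + z)‖ ≤ R := norm_eulerFactor_sub_one_add_le hg hg1 hp hs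
  -- `‖1 + z‖ ≤ exp(Re z + ‖z‖²/2)` (from `1 + u ≤ e^u`)
  have hA : ‖1 + z‖ ≤ Real.exp (z.re + ‖z‖ ^ 2 / 2) := by
    have h1 : ‖1 + z‖ ^ 2 = 1 + 2 * z.re + ‖z‖ ^ 2 := by
      rw [Complex.sq_norm, Complex.sq_norm, Complex.normSq_apply, Complex.normSq_apply]
      simp; ring
    have h2 : ‖1 + z‖ ^ 2 ≤ Real.exp (2 * z.re + ‖z‖ ^ 2) := by
      rw [h1]; have := Real.add_one_le_exp (2 * z.re + ‖z‖ ^ 2); linarith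
    have h3 : Real.exp (2 * z.re + ‖z‖ ^ 2) = Real.exp (z.re + ‖z‖ ^ 2 / 2) ^ 2 := by
      rw [← Real.exp_nat_mul]; congr 1; ring
    rw [h3] at h2
    exact (pow_le_pow_iff_left₀ (norm_nonneg _) (Real.exp_pos _).le two_ne_zero).1 h2
  -- `‖1 + z‖ ≥ 1/2`, `‖F_p‖ ≤ ‖1+z‖ + R ≤ ‖1+z‖ (1 + 2R) ≤ exp(Re z + ‖z‖²/2) exp(2R)`
  have h1z : 1 / 2 ≤ ‖1 + z‖ := by
    have := norm_sub_norm_le (1 : ℂ) (-z)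
    rw [norm_one, norm_neg, sub_neg_eq_add] at this
    have hzn2 : ‖z‖ ≤ 1 / 2 := hzn.trans (by rw [inv_eq_one_div]; exact one_div_le_one_div_of_le two_pos hp2)
    linarith
  have hstep : ‖eulerFactor g p s‖ ≤ ‖1 + z‖ * (1 + 2 * R) := by
    have := norm_le_norm_add_norm_sub' (eulerFactor g p s) (1 + z)
    nlinarith [happrox, h1z, hR0]
  have hexpR : 1 + 2 * R ≤ Real.exp (2 * R) := by have := Real.add_one_le_exp (2 * R); linarith
  have hz2 : ‖z‖ ^ 2 / 2 ≤ R := by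
    rw [hR]
    have h1 : ‖z‖ ^ 2 ≤ (p : ℝ)⁻¹ ^ 2 := pow_le_pow_left₀ (norm_nonneg _) hzn 2
    have h2 : (p : ℝ)⁻¹ ^ 2 / 2 ≤ 1 / ((p : ℝ) * ((p : ℝ) - 1)) := by
      rw [inv_pow, ← one_div, div_div, div_le_div_iff₀ (by positivity) hpp]
      nlinarith
    linarith [div_le_div_of_nonneg_right h1 zero_le_two]
  calc ‖eulerFactor g p s‖ ≤ ‖1 + z‖ * (1 + 2 * R) := hstep
    _ ≤ Real.exp (z.re + ‖z‖ ^ 2 / 2) * Real.exp (2 * R) :=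
        mul_le_mul hA hexpR (by linarith) (Real.exp_pos _).le
    _ = Real.exp (z.re + ‖z‖ ^ 2 / 2 + 2 * R) := by rw [← Real.exp_add]
    _ ≤ Real.exp (z.re + 3 / ((p : ℝ) * ((p : ℝ) - 1))) := by
        refine Real.exp_le_exp.2 ?_
        have : 2 * R + R = 3 / ((p : ℝ) * ((p : ℝ) - 1)) := by rw [hR]; ring
        linarith

/-! ### The two-point sum `Re(f(p)p^{-1-iy} + f(p)p^{-1-i(y+β)}) ≤ 2|cos((β/2) log p)|/p` -/

/-- `‖1 + p^{-iβ}‖ = 2|cos((β/2) log p)|` for `p ≥ 1`. [folklore] -/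
theorem norm_one_add_natCast_cpow_neg_mul_I {p : ℕ} (hp : 0 < p) (β : ℝ) :
    ‖1 + (p : ℂ) ^ (-(β * I))‖ = 2 * |Real.cos (β / 2 * Real.log p)| := by
  have hp0 : (p : ℂ) ≠ 0 := by exact_mod_cast hp.ne'
  set θ : ℝ := β * Real.log p with hθ
  have hw : (p : ℂ) ^ (-(β * I)) = Complex.exp (-(θ : ℂ) * I) := by
    rw [Complex.cpow_def_of_ne_zero hp0, ← Complex.natCast_log, hθ]
    push_cast
    ring_nf
  have hfac : (1 : ℂ) + Complex.exp (-(θ : ℂ) * I) =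
      Complex.exp (-((θ / 2 : ℝ) : ℂ) * I) * (2 * Complex.cos ((θ / 2 : ℝ) : ℂ)) := by
    rw [Complex.two_cos, mul_add, ← Complex.exp_add, ← Complex.exp_add]
    push_cast
    ring_nf
    simp [add_comm]
  rw [hw, hfac, norm_mul, show -((θ / 2 : ℝ) : ℂ) * I = ((-(θ / 2) : ℝ) : ℂ) * I by push_cast; ring,
    Complex.norm_exp_ofReal_mul_I, one_mul, ← Complex.ofReal_cos, ← Complex.ofReal_ofNat,
    ← Complex.ofReal_mul, Complex.norm_real, Real.norm_eq_abs, abs_mul, abs_two, hθ]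
  congr 2
  ring

/-- For `p ≥ 2`, `|f(p)| ≤ 1`: `Re(f(p)p^{-(1+iy)} + f(p)p^{-(1+i(y+β))}) ≤ 2|cos((β/2) log p)|/p`
("`≪ exp(∑_{p≤x} |1 + p^{-iβ}|/p) = exp(∑ 2|cos((|β|/2)log p)|/p)`", (2.7)).
[cite: GranvilleSoundararajan2003, (2.7)] -/
theorem re_add_le_two_mul_abs_cos {g : ℕ → ℂ} (hg : ∀ n, ‖g n‖ ≤ 1) {p : ℕ} (hp : 2 ≤ p)
    (y β : ℝ) :
    (g p * (p : ℂ) ^ (-(1 + y * I)) + g p * (p : ℂ) ^ (-(1 + (y + β) * I))).re ≤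
      2 * |Real.cos (β / 2 * Real.log p)| / p := by
  have hp0' : 0 < p := by omega
  have hp0 : (p : ℂ) ≠ 0 := by exact_mod_cast hp0'.ne'
  have hsplit : (p : ℂ) ^ (-(1 + (y + β) * I)) = (p : ℂ) ^ (-(1 + y * I)) * (p : ℂ) ^ (-(β * I)) := by
    rw [← Complex.cpow_add _ _ hp0]; congr 1; ring
  have hfactor : g p * (p : ℂ) ^ (-(1 + y * I)) + g p * (p : ℂ) ^ (-(1 + (y + β) * I)) =
      g p * (p : ℂ) ^ (-(1 + y * I)) * (1 + (p : ℂ) ^ (-(β * I))) := by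
    rw [hsplit]; ring
  rw [hfactor]
  refine (Complex.re_le_norm _).trans ?_
  have hs : (1 + y * I : ℂ).re = 1 := by simp
  rw [norm_mul, norm_mul, norm_natCast_cpow_neg_of_re_eq_one hp hs,
    norm_one_add_natCast_cpow_neg_mul_I hp0' β]
  have hp0r : (0 : ℝ) < p := by exact_mod_cast hp0'
  calc ‖g p‖ * (p : ℝ)⁻¹ * (2 * |Real.cos (β / 2 * Real.log p)|)
      ≤ 1 * (p : ℝ)⁻¹ * (2 * |Real.cos (β / 2 * Real.log p)|) := by gcongr; exact hg p
    _ = 2 * |Real.cos (β / 2 * Real.log p)| / p := by field_simp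

/-! ### (2.7): the Euler product -/

/-- **(2.7) of Granville–Soundararajan**: for `|f| ≤ 1` with `f(1) = 1` and any `x`, `y`, `β`,
`‖F(1+iy) F(1+i(y+β))‖ ≤ e⁶ exp(2 ∑_{p ≤ x} |cos((β/2) log p)|/p)`.
[cite: GranvilleSoundararajan2003, (2.7)] -/
theorem norm_truncEulerProduct_mul_le {g : ℕ → ℂ} (hg : ∀ n, ‖g n‖ ≤ 1) (hg1 : g 1 = 1)
    (x y β : ℝ) :
    ‖truncEulerProduct g x (1 + y * I) * truncEulerProduct g x (1 + (y + β) * I)‖ ≤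
      Real.exp 6 * Real.exp (2 * ∑ p ∈ Nat.primesLE ⌊x⌋₊, |Real.cos (β / 2 * Real.log p)| / p) := by
  set P := Nat.primesBelow (⌊x⌋₊ + 1) with hP
  have hPeq : P = Nat.primesLE ⌊x⌋₊ := rfl
  have hmem : ∀ p ∈ P, 2 ≤ p := fun p hp => (Nat.prime_of_mem_primesBelow hp).two_le
  set s₁ : ℂ := 1 + y * I with hs₁
  set s₂ : ℂ := 1 + (y + β) * I with hs₂
  have hs₁re : s₁.re = 1 := by simp [hs₁]
  have hs₂re : s₂.re = 1 := by simp [hs₂]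
  -- product of the factor bounds
  have h1 : ‖truncEulerProduct g x s₁ * truncEulerProduct g x s₂‖ ≤
      ∏ p ∈ P, Real.exp ((g p * (p : ℂ) ^ (-s₁)).re + 3 / ((p : ℝ) * ((p : ℝ) - 1)) +
        ((g p * (p : ℂ) ^ (-s₂)).re + 3 / ((p : ℝ) * ((p : ℝ) - 1)))) := by
    rw [truncEulerProduct, truncEulerProduct, ← hP, ← Finset.prod_mul_distrib, norm_prod]
    refine Finset.prod_le_prod (fun p _ => norm_nonneg _) fun p hp => ?_
    rw [norm_mul, Real.exp_add]
    exact mul_le_mul (norm_eulerFactor_le_exp_re hg hg1 (hmem p hp) hs₁re)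
      (norm_eulerFactor_le_exp_re hg hg1 (hmem p hp) hs₂re) (norm_nonneg _) (Real.exp_pos _).le
  rw [← Real.exp_sum] at h1
  refine h1.trans ?_
  rw [← Real.exp_add, Real.exp_le_exp, Finset.mul_sum, ← hPeq]
  have hterm : ∀ p ∈ P, (g p * (p : ℂ) ^ (-s₁)).re + 3 / ((p : ℝ) * ((p : ℝ) - 1)) +
      ((g p * (p : ℂ) ^ (-s₂)).re + 3 / ((p : ℝ) * ((p : ℝ) - 1))) ≤
        6 * (1 / ((p : ℝ) * ((p : ℝ) - 1))) + 2 * (|Real.cos (β / 2 * Real.log p)| / p) := by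
    intro p hp
    have hre := re_add_le_two_mul_abs_cos hg (hmem p hp) y β
    rw [Complex.add_re] at hre
    rw [hs₁, hs₂]
    have : 2 * |Real.cos (β / 2 * Real.log p)| / p = 2 * (|Real.cos (β / 2 * Real.log p)| / p) := by ring
    have hdiv : 3 / ((p : ℝ) * ((p : ℝ) - 1)) = 3 * (1 / ((p : ℝ) * ((p : ℝ) - 1))) := by ring
    linarith
  refine (Finset.sum_le_sum hterm).trans ?_
  rw [Finset.sum_add_distrib, ← Finset.mul_sum, ← Finset.mul_sum]
  have htail := Literature.NumberTheory.LFunctions.MertensBound.sum_inv_prime_mul_pred_le_one ⌊x⌋₊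
  rw [← hPeq] at htail
  nlinarith [htail]

/-! ### Lemma 2.3 -/

/-- **Granville–Soundararajan 2003, Lemma 2.3** — PROVED: there is an absolute `C` such that for every
multiplicative `f` with `|f(n)| ≤ 1`, every `x ≥ 3`, all real `y` and `1/log x ≤ |β| ≤ log x`,
`|F(1+iy) F(1+i(y+β))| ≤ C (log x)^{4/π} max(1/|β|, (log log x)²)^{2(1-2/π)}`.
[cite: GranvilleSoundararajan2003, Lemma 2.3] -/
theorem GranvilleSoundararajan2003_lemma23_holds : GranvilleSoundararajan2003_lemma23 := by
  obtain ⟨K, hK⟩ := sum_abs_cos_log_prime_div_le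
  refine ⟨Real.exp (6 + 2 * K), fun f hf hfb x hx y β hβ1 hβ2 => ?_⟩
  have hx0 : 0 < x := by linarith
  have hlog : 0 < Real.log x := Real.log_pos (by linarith)
  have hβ : 0 < |β| := lt_of_lt_of_le (by positivity) hβ1
  set M : ℝ := max (1 / |β|) (Real.log (Real.log x) ^ 2) with hM
  have hM0 : 0 < M := lt_of_lt_of_le (by positivity) (le_max_left _ _)
  have h1 := norm_truncEulerProduct_mul_le hfb hf.map_one x y β
  have h2 := hK x hx β hβ1 hβ2
  rw [← hM] at h2
  have h3 : 2 * ∑ p ∈ Nat.primesLE ⌊x⌋₊, |Real.cos (β / 2 * Real.log p)| / p ≤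
      2 * (2 / π * Real.log (Real.log x) + (1 - 2 / π) * Real.log M + K) := by linarith
  calc ‖truncEulerProduct f x (1 + y * I) * truncEulerProduct f x (1 + (y + β) * I)‖
      ≤ Real.exp 6 * Real.exp (2 * ∑ p ∈ Nat.primesLE ⌊x⌋₊, |Real.cos (β / 2 * Real.log p)| / p) := h1
    _ ≤ Real.exp 6 * Real.exp (2 * (2 / π * Real.log (Real.log x) + (1 - 2 / π) * Real.log M + K)) := by
        gcongr
    _ = Real.exp (6 + 2 * K) * Real.log x ^ (4 / π) * M ^ (2 * (1 - 2 / π)) := by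
        rw [Real.rpow_def_of_pos hlog, Real.rpow_def_of_pos hM0, ← Real.exp_add, ← Real.exp_add,
          ← Real.exp_add]
        congr 1; ring

end Literature.NumberTheory.LFunctions.GranvilleSoundararajan
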